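import Summits.KontsevichZagierPeriods.KontsevichZagierPeriods.Theses.HurwitzMicroSectors
import Summits.KontsevichZagierPeriods.KontsevichZagierPeriods.Theorems.HurwitzMicroSectorsNormalFormPrinciplePiBoxTransfer
import Summits.KontsevichZagierPeriods.KontsevichZagierPeriods.Theorems.HurwitzMicroSectorsNormalFormPrincipleVariants2238
import Summits.KontsevichZagierPeriods.KontsevichZagierPeriods.Theorems.HurwitzMicroSectorsNormalFormPrincipleVariants2320

/-! TTRL-lite variant V2275 of stmt-KontsevichZagierPeriods-3869

Variant V2275 = `stub_boxRigidity` (the leaf `BoxRigidity` of `NormalFormPrinciple`: two BOX-RATIONAL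
representations — domain the open unit box, integrand `p/q` over `ℚ` — with equal values are
KZ-equivalent) under the move `fix_nat:m=4; bound_nat:m'≤5` (left dimension frozen to `4`, right
dimension `m' ≤ 5`). Verdict of the attempt seat: **open** — this file is the exact-strength
certificate, not a proof of the variant. Here the bound EXCEEDS the frozen dimension, so the strength
is set by the right-hand side: by the tree's general fact `boxRigidityFixBound_iff_boxVanishing_snd`
(file `…Variants2320`, case `K = 4 ≤ b = 5`) the variant is EXACTLY BoxVanishing in dimension `5`
(every box-rational representation on `(0,1)⁵` of value `0` is a KZ relation;
`stub_boxRigidity_var2275_iff_boxVanishing_five`) — forward by comparing the zero representation on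
`(0,1)⁴` with a vanishing representation on `(0,1)⁵` (pair `(4, 5)`, allowed), backward by padding both
representations to `(0,1)⁵` and subtracting there (`boxRigidityLe_of_boxVanishing`, file `…Variants2239`).
Equivalently: BoxRigidity under the joint bound `m, m' ≤ 5` (`stub_boxRigidity_var2275_iff_le_five`),
and the same statement as the sibling V2283 (`fix_nat:m=5; fix_nat:m'=2`,
`stub_boxRigidity_var2275_iff_var2283`, proved from the ladder lemmas without importing that
certificate); it implies BoxVanishing in every dimension `≤ 5`
(`boxVanishing_le_five_of_stub_boxRigidity_var2275`) and the sibling V2272 (`m = 4`, `m' ≤ 4`,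
= BoxVanishing `4`; `stub_boxRigidity_var2272_of_var2275`). BoxVanishing `5` is Conjecture 1 of
Kontsevich–Zagier for all pairs of rational integrands on the boxes `(0,1)^{≤ 5}` (`ζ(5)`, `π⁴`,
`ζ(3)`, `β(4)`, `Li₅` at rationals, Catalan's `G` versus `π²`, …); the tree proves only dimension `≤ 1`
(`boxRigidity_of_le_one`, Baker). Conversely `KontsevichZagierPeriods ⇒ parent ⇒ V2275`
(`stub_boxRigidity_var2275_of_statement`), so a refutation of the variant would refute the Summit, and
no invariant of `KZ.relations` finer than `eval` is known.
Source: M. Kontsevich, D. Zagier, *Periods* (2001), §1.2 Conjecture 1. Pure proof file, no definitions. -/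

-- `Summit.<Summit>.<Problem>` is the tree's mandated summit-side namespace (CONVENTIONS §2); for this
-- single-conjunct summit the two coincide, so the duplicate is deliberate.
set_option linter.dupNamespace false

noncomputable section

namespace Summit.KontsevichZagierPeriods.KontsevichZagierPeriods.Theorems

open MeasureTheory Set
open Literature.NumberTheory.Transcendental Literature.NumberTheory.Transcendental.KZ
open Summit.KontsevichZagierPeriods.KontsevichZagierPeriods.Theses.HurwitzMicroSectors
open Summit.KontsevichZagierPeriods.HurwitzMicroSectors.NormalFormPrinciple.PiBox

/-! ## The variant V2275: exactly `BoxVanishing 5` -/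

/-- **V2275 ⟺ BoxVanishing in dimension `5`** (every box-rational representation on `(0,1)⁵` of
value `0` is a KZ relation): instance `K = 4 ≤ b = 5` of `boxRigidityFixBound_iff_boxVanishing_snd`.
[cite: KontsevichZagier2001, §1.2 Conjecture 1] -/
theorem stub_boxRigidity_var2275_iff_boxVanishing_five :
    (∀ (m' : ℕ) (N : IntegralRep 4) (N' : IntegralRep m'), m' ≤ 5 → N.domain = {x | ∀ i, x i ∈ Set.Ioo (0:ℝ) 1} → N.IsRational → N'.domain = {x | ∀ i, x i ∈ Set.Ioo (0:ℝ) 1} → N'.IsRational → N.value = N'.value → Equivalent N N') ↔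
    (∀ (M : IntegralRep 5), M.domain = {x | ∀ i, x i ∈ Set.Ioo (0:ℝ) 1} → M.IsRational →
      M.value = 0 → of M ∈ relations) :=
  boxRigidityFixBound_iff_boxVanishing_snd (by norm_num)

/-- **V2275 ⟺ BoxRigidity under the joint bound `m, m' ≤ 5`** (the honest strength of the variant:
freezing `m := 4` loses nothing once `m' ≤ 5` is allowed). [cite: KontsevichZagier2001, §1.2 Conjecture 1] -/
theorem stub_boxRigidity_var2275_iff_le_five :
    (∀ (m' : ℕ) (N : IntegralRep 4) (N' : IntegralRep m'), m' ≤ 5 → N.domain = {x | ∀ i, x i ∈ Set.Ioo (0:ℝ) 1} → N.IsRational → N'.domain = {x | ∀ i, x i ∈ Set.Ioo (0:ℝ) 1} → N'.IsRational → N.value = N'.value → Equivalent N N') ↔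
    (∀ (m m' : ℕ) (N : IntegralRep m) (N' : IntegralRep m'), m ≤ 5 → m' ≤ 5 →
      N.domain = {x | ∀ i, x i ∈ Set.Ioo (0:ℝ) 1} → N.IsRational →
      N'.domain = {x | ∀ i, x i ∈ Set.Ioo (0:ℝ) 1} → N'.IsRational →
      N.value = N'.value → Equivalent N N') := by
  rw [stub_boxRigidity_var2275_iff_boxVanishing_five]
  exact ⟨fun hvan m m' N N' hm hm' => boxRigidityLe_of_boxVanishing (j := 5) (k := 5) le_rfl le_rfl
      hvan m m' N N' hm' hm,
    fun h => boxVanishingDim_left_of_pair 5 5 fun N N' => h 5 5 N N' le_rfl le_rfl⟩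

/-- **V2275 ⇒ BoxVanishing in every dimension `≤ 5`** (monotonicity along padding,
`boxVanishing_mono`). [cite: KontsevichZagier2001, §1.2 Conjecture 1] -/
theorem boxVanishing_le_five_of_stub_boxRigidity_var2275
    (h : ∀ (m' : ℕ) (N : IntegralRep 4) (N' : IntegralRep m'), m' ≤ 5 → N.domain = {x | ∀ i, x i ∈ Set.Ioo (0:ℝ) 1} → N.IsRational → N'.domain = {x | ∀ i, x i ∈ Set.Ioo (0:ℝ) 1} → N'.IsRational → N.value = N'.value → Equivalent N N')
    {j : ℕ} (hj : j ≤ 5) (N : IntegralRep j) (hNd : N.domain = {x | ∀ i, x i ∈ Set.Ioo (0:ℝ) 1})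
    (hNr : N.IsRational) (hv : N.value = 0) : of N ∈ relations :=
  boxVanishing_mono hj (stub_boxRigidity_var2275_iff_boxVanishing_five.1 h) N hNd hNr hv

/-- **V2275 ⟺ V2283** (`fix_nat:m=5; fix_nat:m'=2`): both are BoxVanishing in dimension `5`
(for the pair `(5, 2)`: forward `boxRigidityLe_of_boxVanishing`, backward
`boxVanishingDim_left_of_pair 5 2`). [cite: KontsevichZagier2001, §1.2 Conjecture 1] -/
theorem stub_boxRigidity_var2275_iff_var2283 :
    (∀ (m' : ℕ) (N : IntegralRep 4) (N' : IntegralRep m'), m' ≤ 5 → N.domain = {x | ∀ i, x i ∈ Set.Ioo (0:ℝ) 1} → N.IsRational → N'.domain = {x | ∀ i, x i ∈ Set.Ioo (0:ℝ) 1} → N'.IsRational → N.value = N'.value → Equivalent N N') ↔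
    (∀ (N : IntegralRep 5) (N' : IntegralRep 2), N.domain = {x | ∀ i, x i ∈ Set.Ioo (0:ℝ) 1} → N.IsRational → N'.domain = {x | ∀ i, x i ∈ Set.Ioo (0:ℝ) 1} → N'.IsRational → N.value = N'.value → Equivalent N N') := by
  rw [stub_boxRigidity_var2275_iff_boxVanishing_five]
  exact ⟨fun hvan N N' => boxRigidityLe_of_boxVanishing (j := 5) (k := 5) le_rfl le_rfl
      hvan 5 2 N N' (by norm_num) le_rfl,
    fun h => boxVanishingDim_left_of_pair 5 2 h⟩

/-- **V2275 ⇒ the sibling V2272** (`fix_nat:m=4; bound_nat:m'≤4`, = BoxVanishing `4`): restrict the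
bound. [cite: KontsevichZagier2001, §1.2 Conjecture 1] -/
theorem stub_boxRigidity_var2272_of_var2275
    (h : ∀ (m' : ℕ) (N : IntegralRep 4) (N' : IntegralRep m'), m' ≤ 5 → N.domain = {x | ∀ i, x i ∈ Set.Ioo (0:ℝ) 1} → N.IsRational → N'.domain = {x | ∀ i, x i ∈ Set.Ioo (0:ℝ) 1} → N'.IsRational → N.value = N'.value → Equivalent N N') :
    ∀ (m' : ℕ) (N : IntegralRep 4) (N' : IntegralRep m'), m' ≤ 4 → N.domain = {x | ∀ i, x i ∈ Set.Ioo (0:ℝ) 1} → N.IsRational → N'.domain = {x | ∀ i, x i ∈ Set.Ioo (0:ℝ) 1} → N'.IsRational → N.value = N'.value → Equivalent N N' :=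
  fun m' N N' hm' => h m' N N' (hm'.trans (by norm_num))

/-- **The parent leaf ⇒ V2275** (specialisation `m = 4`; the bound `m' ≤ 5` is dropped).
[cite: KontsevichZagier2001, §1.2 Conjecture 1] -/
theorem stub_boxRigidity_var2275_of_parent
    (h : ∀ (m m' : ℕ) (N : IntegralRep m) (N' : IntegralRep m'), N.domain = {x | ∀ i, x i ∈ Set.Ioo (0:ℝ) 1} → N.IsRational → N'.domain = {x | ∀ i, x i ∈ Set.Ioo (0:ℝ) 1} → N'.IsRational → N.value = N'.value → Equivalent N N') :
    ∀ (m' : ℕ) (N : IntegralRep 4) (N' : IntegralRep m'), m' ≤ 5 → N.domain = {x | ∀ i, x i ∈ Set.Ioo (0:ℝ) 1} → N.IsRational → N'.domain = {x | ∀ i, x i ∈ Set.Ioo (0:ℝ) 1} → N'.IsRational → N.value = N'.value → Equivalent N N' :=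
  fun m' N N' _ => h 4 m' N N'

/-- **`KontsevichZagierPeriods ⇒ V2275`**: the variant is a special case of Conjecture 1 for the
tree's calculus (`leaves_of_statement`) — so a refutation of the variant would refute the Summit.
[cite: KontsevichZagier2001, §1.2 Conjecture 1] -/
theorem stub_boxRigidity_var2275_of_statement (h : _root_.KontsevichZagierPeriods) :
    ∀ (m' : ℕ) (N : IntegralRep 4) (N' : IntegralRep m'), m' ≤ 5 → N.domain = {x | ∀ i, x i ∈ Set.Ioo (0:ℝ) 1} → N.IsRational → N'.domain = {x | ∀ i, x i ∈ Set.Ioo (0:ℝ) 1} → N'.IsRational → N.value = N'.value → Equivalent N N' :=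
  stub_boxRigidity_var2275_of_parent (leaves_of_statement h).1

end Summit.KontsevichZagierPeriods.KontsevichZagierPeriods.Theorems

end
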